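import Mathlib

/-!
# [B8] (1.91) vs [4] (3.163)–(3.165): WHEN does Q′ΔN(Q′) = 0 hold? — a kernel-checked characterization
# (cell GAPS G-B8-19 (c): replaces the by-hand parenthesis of `B8Eq194FirstTerm` §2 and corrects one clause of it)

statement-level skeleton of published theorems with citation tags; proofs where landed; nothing here is a claim
about the Yang–Mills mass gap

Seat p40 gen 8, Phase 2, B8 lane (rows B8.Eq1.91 / B8.Eq1.95 are r05's; xref B9.Eq3.162).  Kind: located reading
note, constants only — NOT an error of either paper; the ERRATUM below is to our own cell text.

CONTEXT.  `B8Eq194FirstTerm` (p40 gen 7) proved over the (3.25)-data of [4] that the operator [4] calls H′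
((3.163) = (3.164), p. 429, «RΔλ₀ = 0») coincides with the H′ of [B8] (1.91) iff **Q′ΔN(Q′) = 0**, i.e. Δ maps
N(Q′) = {λ : Q′λ = 0} ((3.21) p. 394) into itself (`forall_R_qs_eq_zero_iff`, `H4_eq_Hp_of_criterion`), showed
that this FAILS on the six-site torus with two blocks of three sites (`Witness6.criterion_fails6`), and added BY
HAND (not kernel-checked): «the same happens for the Dirichlet three-site block of [4] p. 394 — λ = (1, −2, 1),
Q′Δλ = 2/3 — and in every d; it does NOT happen when no bond of Δ joins two blocks or leaves Ω₀», which GAPS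
G-B8-19 (b) condensed to «fails as soon as a bond of Δ joins two blocks».  This file and its sibling
`B8Eq194CriterionTorus` kernel-check that parenthesis in the scalar model — 𝔤 = ℝ and flat background, where the
covariant Laplace operator Δ_U = D*_U D_U of (3.23) (with [4]'s Dirichlet boundary conditions on ∂Ω₀, p. 394) is a
weighted graph Laplacian with a diagonal term and Q′ of (3.18)–(3.19) is the block mean — and CORRECT one clause.

CONTENT (this file; S = any finite site set, blk : S → B any block map — blocks of several sizes as in (3.18) are
allowed —, w : S → S → ℝ any bond weights, m : S → ℝ any diagonal «Dirichlet» term;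
(Δf)(y) = m(y) f(y) + Σ_x w(y,x) (f(y) − f(x)) is `lap w m`; N(Q′) is `InKer blk`; the criterion is `Crit w m blk`):
* `blockSum_lap` — Σ_{y ∈ b′} (Δf)(y) = Σ_x c_{b′}(x) f(x) with the COEFFICIENT VECTOR
  c_{b′}(x) = [blk x = b′](m(x) + Σ_z w(x,z)) − Σ_{y ∈ b′} w(y,x) (`coef`);
* `sum_mul_eq_zero_of_blockConst` / `blockConst_of_forall_inKer` — a functional Σ_x c(x)f(x) kills N(Q′) iff c is
  constant on every block (N(Q′)^⊥ = Ran Q′*; test vectors δ_x − δ_y);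
* **`crit_iff`** — Q′ΔN(Q′) = 0 ⟺ every c_{b′} is constant on every block;
* `crit_of_injective` — one-site blocks (L = 1): holds for every Δ;
* `coef_of_noCross`, **`crit_iff_of_noCross`** — w symmetric and no bond joining two different blocks:
  c_{b′}(x) = [blk x = b′] m(x), so the criterion holds iff m is constant on blocks: it HOLDS when moreover no bond
  leaves Ω₀ (`crit_of_noCross`, the positive half of the by-hand clause) and FAILS on a block met non-uniformly
  by ∂Ω₀-bonds — [4]'s Dirichlet three-site block: `not_crit_dirichlet3`, with the by-hand numbers now
  kernel-checked (`dirichlet3_witness`: λ = (1, −2, 1) ∈ N(Q′), block sum of Δλ = 2, i.e. block mean 2/3 ≠ 0).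
The sibling `B8Eq194CriterionTorus` adds the PRODUCT RULE (a Kronecker-sum Laplacian with product blocks satisfies
the criterion iff every factor does — the «in every d» clause) and the COMPLETE ANSWER on the periodic chains
ℤ/(LK) with K blocks of L consecutive sites and on the tori (ℤ/(LK))^d with cubic blocks of side L:
**Q′ΔN(Q′) = 0 ⟺ L = 1 ∨ K = 1 ∨ (L, K) = (2, 2)** (`crit_cyc_iff`, `crit_torus_iff`).

ERRATUM (to GAPS G-B8-19 (b) and the docstring of `B8Eq194FirstTerm`, not to the papers).  «Fails as soon as a
bond of Δ joins two blocks» is false as stated: on the 4-cycle with two blocks of two sites, and on every torus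
(ℤ/4)^d cut into 2^d-site cubes, every site has a bond into another block and yet Q′ΔN(Q′) = 0
(`B8Eq194CriterionTorus.crit_cyc_two_two`, `crit_torus_iff`); there (1.91)'s H′ IS [4]'s H′ by
`B8Eq194FirstTerm.H4_eq_Hp_of_criterion`.  Corrected wording: «on (ℤ/(LK))^d the criterion fails as soon as
L ≥ 2 and K ≥ 2, except for (L, K) = (2, 2); it holds for L = 1, for K = 1, for (L, K) = (2, 2), and whenever no
bond joins two blocks or leaves Ω₀».  For [B8]'s geometry (K = number of unit-lattice points per direction of T¹,
large) the conclusion of (b) — the H′ of (1.91) is not the operator of [4] (3.163) — stands unchanged.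

HONEST SCOPE.  (i) Scalar model: 𝔤 = ℝ, U flat; for non-abelian 𝔤 and U ≠ 1 the parallel transports R(U(Γ)) enter
Q′ ((3.19)) and Δ_U ((3.23)) and nothing here applies verbatim (the linear algebra of `B8Eq194FirstTerm` does).
(ii) Q′ is taken as the block SUM (`blockSum`); the block mean of (3.19) (factor L^{−d}), or any blockwise non-zero
rescaling, has the same kernel N(Q′) and the same image blocks, hence the same criterion.  (iii) In §1 the weights
w need be neither symmetric nor non-negative (`crit_iff`); symmetry is used from `coef_of_noCross` on.  (iv) No
bound, no row head changes; value = a kernel-checked replacement of a by-hand parenthesis in the tree, one clause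
corrected.

Sources read: [Balaban1985RegularSpaces] T. Bałaban, Spaces of regular gauge field configurations on a lattice and
gauge fixing conditions, CMP 99 (1985) 75–102: (1.91) p. 91 [PDF 17] (render `pub-balaban/b2b-balaban-ref1/pages/
1985-cmp99-regular-spaces-gauge-fixing/…-p017-x2.png`); [Balaban1985BackgroundPropagators] T. Bałaban,
Propagators for lattice gauge theories in a background field, CMP 99 (1985) 389–434: (3.18)–(3.19) p. 393,
(3.21)–(3.25) p. 394, (3.162)–(3.165) p. 429 [PDF 5, 6, 41] (OCR pages p0005, p0006, p0041 of
`paper:balaban1985-cmp99-background-propagators`).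
-/

namespace Literature.MathematicalPhysics.QuantumFieldTheory.Balaban1983to89.B8Eq194Criterion

open Finset

/-! ## §1  Block sums, N(Q′), block-constant coefficient vectors, the criterion -/

section General

variable {S B : Type*} [Fintype S] [DecidableEq B]

/-- Block sum `Σ_{x : blk x = b} f x` — the averaging operator Q′ of [4] (3.18)–(3.19) up to the positive block factor
(same kernel N(Q′)). [cite: Balaban1985BackgroundPropagators, (3.18)–(3.19) p. 393 and (3.21) p. 394] -/
def blockSum (blk : S → B) (f : S → ℝ) (b : B) : ℝ := ∑ x ∈ univ with blk x = b, f x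

/-- `f ∈ N(Q′)`: all block sums vanish. [cite: Balaban1985BackgroundPropagators, (3.21) p. 394] -/
def InKer (blk : S → B) (f : S → ℝ) : Prop := ∀ b, blockSum blk f b = 0

/-- `c` is constant on every block (`c ∈ N(Q′)^⊥`). [cite: Balaban1985BackgroundPropagators, (3.21) p. 394] -/
def BlockConst (blk : S → B) (c : S → ℝ) : Prop := ∀ x y, blk x = blk y → c x = c y

/-- The finite weighted Laplace operator with a diagonal (Dirichlet) term:
`(Δf)(y) = m(y) f(y) + Σ_x w(y,x) (f(y) − f(x))`; for the covariant Laplacian Δ^η_{U₀} on scalar (𝔤 = ℝ)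
test functions w = bond indicator, m = number of bonds leaving Ω₀.
[cite: Balaban1985BackgroundPropagators, (3.23) p. 394; Balaban1985RegularSpaces, (1.91) p. 91] -/
def lap (w : S → S → ℝ) (m : S → ℝ) (f : S → ℝ) (y : S) : ℝ := m y * f y + ∑ x, w y x * (f y - f x)

/-- The criterion of `B8Eq194FirstTerm.forall_R_qs_eq_zero_iff`: Δ maps N(Q′) into N(Q′)
(«Q′ΔN(Q′) = 0»). [cite: Balaban1985BackgroundPropagators, (3.163)–(3.165) p. 429;
Balaban1985RegularSpaces, (1.91) p. 91] -/
def Crit (w : S → S → ℝ) (m : S → ℝ) (blk : S → B) : Prop := ∀ f, InKer blk f → InKer blk (lap w m f)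

/-- The coefficient vector of the functional f ↦ (block sum of Δf over b′):
`c_{b′}(x) = [blk x = b′](m x + Σ_z w x z) − Σ_{y : blk y = b′} w y x`.
[cite: Balaban1985BackgroundPropagators, (3.23) and (3.21) p. 394] -/
def coef (w : S → S → ℝ) (m : S → ℝ) (blk : S → B) (b' : B) (x : S) : ℝ :=
  (if blk x = b' then m x + ∑ z, w x z else 0) - ∑ y ∈ univ with blk y = b', w y x

/-- Block sums as indicator sums. [cite: Balaban1985BackgroundPropagators, (3.18)–(3.19) p. 393] -/
theorem blockSum_def (blk : S → B) (f : S → ℝ) (b : B) :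
    blockSum blk f b = ∑ x, if blk x = b then f x else 0 := by
  unfold blockSum; rw [Finset.sum_filter]

/-- A block-constant functional kills N(Q′). [cite: Balaban1985BackgroundPropagators, (3.21) p. 394] -/
theorem sum_mul_eq_zero_of_blockConst {blk : S → B} {c f : S → ℝ} (hc : BlockConst blk c)
    (hf : InKer blk f) : ∑ x, c x * f x = 0 := by
  classical
  rw [← Finset.sum_fiberwise_of_maps_to (s := univ) (t := univ.image blk) (g := blk)
    (fun x _ => mem_image_of_mem blk (mem_univ x))]
  refine Finset.sum_eq_zero fun b hb => ?_
  obtain ⟨x₀, -, rfl⟩ := mem_image.1 hb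
  have h1 : ∀ x ∈ univ.filter (fun x => blk x = blk x₀), c x * f x = c x₀ * f x := by
    intro x hx
    rw [hc x x₀ (mem_filter.1 hx).2]
  rw [Finset.sum_congr rfl h1, ← Finset.mul_sum]
  have h0 := hf (blk x₀)
  unfold blockSum at h0
  rw [h0, mul_zero]

/-- Conversely, a functional killing N(Q′) is block-constant (test on δ_x − δ_y).
[cite: Balaban1985BackgroundPropagators, (3.21) p. 394] -/
theorem blockConst_of_forall_inKer [DecidableEq S] {blk : S → B} {c : S → ℝ}
    (h : ∀ f, InKer blk f → ∑ x, c x * f x = 0) : BlockConst blk c := by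
  intro x y hxy
  set f : S → ℝ := fun z => (if z = x then (1 : ℝ) else 0) - (if z = y then (1 : ℝ) else 0) with hf
  have hker : InKer blk f := by
    intro b
    unfold blockSum
    simp only [hf, Finset.sum_sub_distrib, Finset.sum_ite_eq', mem_filter, mem_univ, true_and, hxy,
      sub_self]
  have h2 := h f hker
  simp only [hf, mul_sub, Finset.sum_sub_distrib, mul_ite, mul_one, mul_zero, Finset.sum_ite_eq',
    mem_univ, if_true] at h2
  exact sub_eq_zero.1 h2

/-- Block sums of Δf are the pairings with the coefficient vectors `coef`.
[cite: Balaban1985BackgroundPropagators, (3.23) and (3.21) p. 394] -/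
theorem blockSum_lap (w : S → S → ℝ) (m : S → ℝ) (blk : S → B) (f : S → ℝ) (b' : B) :
    blockSum blk (lap w m f) b' = ∑ x, coef w m blk b' x * f x := by
  have h1 : ∀ y, lap w m f y = (m y + ∑ x, w y x) * f y - ∑ x, w y x * f x := by
    intro y
    unfold lap
    rw [add_mul, Finset.sum_mul, add_sub_assoc, ← Finset.sum_sub_distrib]
    congr 1
    exact Finset.sum_congr rfl fun x _ => by ring
  unfold blockSum coef
  simp_rw [h1]
  rw [Finset.sum_sub_distrib, Finset.sum_filter, Finset.sum_comm]
  simp only [sub_mul, ite_mul, zero_mul, Finset.sum_mul, Finset.sum_sub_distrib]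

/-- **Characterization.** Q′ΔN(Q′) = 0 iff every coefficient vector c_{b′} is constant on blocks.
[cite: Balaban1985BackgroundPropagators, (3.163)–(3.165) p. 429; Balaban1985RegularSpaces, (1.91) p. 91] -/
theorem crit_iff [DecidableEq S] {w : S → S → ℝ} {m : S → ℝ} {blk : S → B} :
    Crit w m blk ↔ ∀ b', BlockConst blk (coef w m blk b') := by
  constructor
  · intro h b'
    refine blockConst_of_forall_inKer fun f hf => ?_
    rw [← blockSum_lap]
    exact h f hf b'
  · intro h f hf b'
    rw [blockSum_lap]
    exact sum_mul_eq_zero_of_blockConst (h b') hf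

/-- L = 1 (every block a single site): N(Q′) = 0 and the criterion holds for any Δ.
[cite: Balaban1985BackgroundPropagators, (3.21) p. 394] -/
theorem crit_of_injective [DecidableEq S] {w : S → S → ℝ} {m : S → ℝ} {blk : S → B}
    (hblk : Function.Injective blk) : Crit w m blk :=
  crit_iff.2 fun b' x y hxy => by rw [hblk hxy]

/-- A block b′ containing no site contributes the zero coefficient vector. [cite: Balaban1985BackgroundPropagators,
(3.21) p. 394] -/
theorem coef_eq_zero_of_forall_ne {w : S → S → ℝ} {m : S → ℝ} {blk : S → B} {b' : B}
    (h : ∀ z, blk z ≠ b') (x : S) : coef w m blk b' x = 0 := by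
  unfold coef
  rw [if_neg (h x), zero_sub, neg_eq_zero]
  exact Finset.sum_eq_zero fun y hy => ((h y) (mem_filter.1 hy).2).elim

/-- Off the block b′: c_{b′}(x) = −Σ_{y ∈ b′} w(y,x) (minus the weight of the bonds from x into b′).
[cite: Balaban1985BackgroundPropagators, (3.23) and (3.21) p. 394] -/
theorem coef_of_ne {w : S → S → ℝ} {m : S → ℝ} {blk : S → B} {b' : B} {x : S} (hx : blk x ≠ b') :
    coef w m blk b' x = -∑ y ∈ univ with blk y = b', w y x := by
  unfold coef; rw [if_neg hx, zero_sub]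

/-- With symmetric weights and NO bond joining two different blocks, c_{b′}(x) = [blk x = b′] m(x).
[cite: Balaban1985BackgroundPropagators, (3.23) p. 394] -/
theorem coef_of_noCross {w : S → S → ℝ} {m : S → ℝ} {blk : S → B} (hw : ∀ x y, w x y = w y x)
    (hcross : ∀ x y, blk x ≠ blk y → w x y = 0) (b' : B) (x : S) :
    coef w m blk b' x = if blk x = b' then m x else 0 := by
  unfold coef
  by_cases hx : blk x = b'
  · rw [if_pos hx, if_pos hx]
    have : ∑ y ∈ univ with blk y = b', w y x = ∑ z, w x z := by
      rw [Finset.sum_filter]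
      refine Finset.sum_congr rfl fun y _ => ?_
      by_cases hy : blk y = b'
      · rw [if_pos hy, hw]
      · rw [if_neg hy]
        exact (hcross x y (by rw [hx]; exact Ne.symm hy)).symm
    rw [this]; ring
  · rw [if_neg hx, if_neg hx, zero_sub, neg_eq_zero]
    refine Finset.sum_eq_zero fun y hy => ?_
    have hy' : blk y = b' := (mem_filter.1 hy).2
    rw [hw]
    exact hcross x y (by rw [hy']; exact hx)

/-- No bond joins two blocks (and w symmetric): the criterion holds iff the Dirichlet term m is constant on
blocks — in particular it HOLDS for m = 0 (no bond leaves Ω₀) and FAILS for a block met non-uniformly by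
∂Ω₀-bonds. [cite: Balaban1985BackgroundPropagators, (3.23) p. 394, (3.163)–(3.165) p. 429] -/
theorem crit_iff_of_noCross [DecidableEq S] {w : S → S → ℝ} {m : S → ℝ} {blk : S → B}
    (hw : ∀ x y, w x y = w y x) (hcross : ∀ x y, blk x ≠ blk y → w x y = 0) :
    Crit w m blk ↔ BlockConst blk m := by
  rw [crit_iff]
  constructor
  · intro h x y hxy
    have := h (blk y) x y hxy
    rwa [coef_of_noCross hw hcross, coef_of_noCross hw hcross, if_pos hxy, if_pos rfl] at this
  · intro h b' x y hxy
    rw [coef_of_noCross hw hcross, coef_of_noCross hw hcross, hxy]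
    by_cases hy : blk y = b'
    · rw [if_pos hy, if_pos hy]; exact h x y hxy
    · rw [if_neg hy, if_neg hy]

/-- In particular: no cross-block bond, no Dirichlet term ⇒ Q′ΔN(Q′) = 0.
[cite: Balaban1985BackgroundPropagators, (3.163)–(3.165) p. 429] -/
theorem crit_of_noCross [DecidableEq S] {w : S → S → ℝ} {blk : S → B}
    (hw : ∀ x y, w x y = w y x) (hcross : ∀ x y, blk x ≠ blk y → w x y = 0) :
    Crit w 0 blk :=
  (crit_iff_of_noCross hw hcross).2 fun _ _ _ => rfl

end General

/-! ## §2  The Dirichlet three-site block of [4] p. 394 -/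

section Dirichlet

/-- Path weights on three sites 0 — 1 — 2. [cite: Balaban1985BackgroundPropagators, (3.23) p. 394] -/
def pathW3 (x y : Fin 3) : ℝ := if (y.val = x.val + 1 ∨ x.val = y.val + 1) then 1 else 0

/-- Dirichlet term: one bond leaves Ω₀ = {0, 1, 2} at each end site. [cite: Balaban1985BackgroundPropagators,
(3.23) p. 394 («Dirichlet boundary conditions on ∂Ω₀»)] -/
def dirM3 (x : Fin 3) : ℝ := if x.val = 1 then 0 else 1

/-- One block {0,1,2} with Dirichlet ends: the criterion FAILS (m is not constant on the block).
[cite: Balaban1985BackgroundPropagators, (3.23) p. 394, (3.163)–(3.165) p. 429] -/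
theorem not_crit_dirichlet3 : ¬ Crit pathW3 dirM3 (fun _ : Fin 3 => (0 : ℕ)) := by
  rw [crit_iff_of_noCross (fun x y => by simp only [pathW3, or_comm]) (fun x y hne => (hne rfl).elim)]
  intro h
  have := h 0 1 rfl
  norm_num [dirM3] at this

/-- λ = (1, −2, 1) of `B8Eq194FirstTerm` §2 (there by hand). [cite: Balaban1985BackgroundPropagators, (3.21) p. 394] -/
def lam3 (z : Fin 3) : ℝ := if z.val = 1 then -2 else 1

/-- The by-hand numbers of `B8Eq194FirstTerm` §2, kernel-checked: λ = (1, −2, 1) has zero block sum and the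
block sum of Δλ is 2 (block AVERAGE 2/3 ≠ 0). [cite: Balaban1985BackgroundPropagators, (3.23) and (3.21)
p. 394] -/
theorem dirichlet3_witness :
    InKer (fun _ : Fin 3 => (0 : ℕ)) lam3
      ∧ blockSum (fun _ : Fin 3 => (0 : ℕ)) (lap pathW3 dirM3 lam3) 0 = 2 := by
  constructor
  · intro b
    rw [blockSum_def]
    by_cases hb : (0 : ℕ) = b
    · simp only [hb, if_true, Fin.sum_univ_three]
      norm_num [lam3]
    · simp [hb]
  · rw [blockSum_def]
    norm_num [Fin.sum_univ_three, lap, pathW3, dirM3, lam3]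

end Dirichlet

end Literature.MathematicalPhysics.QuantumFieldTheory.Balaban1983to89.B8Eq194Criterion
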